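import Summits.HodgeConjecture.CorCM.GaloisDegenerateRealQuadraticFactor
import Summits.HodgeConjecture.CorCM.AbelianTwoPowerClassification
import HarnessLib

/-!
# BAD ascends along every quadratic extension split through complex conjugation — the exponent-two case removed by the
# abelian classification

COR-CM (cell `pub-hodgecm2`), binder seat b04 (gen 31), count-neutral own lane «Galois-CM-type classification»; sequel of
`CorCM/GaloisDegenerateRealQuadraticFactor`, whose hypothesis «`Gal(K₀/ℚ)` not of exponent `2`» is DISCHARGED here.  KERNEL
ONLY: theorems; no definition, no named fact, no `sorry`.  `HC_CM` is neither used nor claimed.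

THE CASE `Gal(K₀/ℚ) ≅ C₂ᵏ`.  If `K ⊇ K₀` has degree `2` with a complement `Γ ∋ c` of `Gal(K/K₀)`, then `Gal(K/ℚ) = Gal(K/K₀) × Γ`
is of exponent `2` as well (`sq_eq_one_of_complement_two`), hence abelian of `2`-power order, and gens 13–18's ABELIAN
CLASSIFICATION (`AbelianTwoPowerClassification`) decides everything: if `[K₀:ℚ] ≤ 16` then (β)/(γ) make EVERY primitive CM type
of `K₀` nondegenerate (`isNondegenerate_of_isPrimitive_of_good`), contradicting the BAD hypothesis; if `[K₀:ℚ] ≥ 32` then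
`[K:ℚ] ≥ 64`, complex conjugation lies in no cyclic subgroup of index `≤ 2` of the exponent-`2` group `Gal(K/ℚ)` (¬(α)), and
`exists_simple_degenerate_of_not_thin_of_le_finrank` makes `K` BAD.

THEOREMS.  **`exists_simple_degenerate_of_subfield_complement_two_all`**: `K ⊇ K₀ ⊇ ℚ` Galois CM, `[K:K₀] = 2`, `Γ ≤ Gal(K/ℚ)` a
complement of `Gal(K/K₀)` containing complex conjugation (`Γ ∩ Gal(K/K₀) = 1`, `|Γ| = [K₀:ℚ]`), `K₀` has a PRIMITIVE DEGENERATE CM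
type ⟹ `K` carries a SIMPLE DEGENERATE abelian variety of dimension `[K:ℚ]/2` with CM by `K` — NO hypothesis on `Gal(K₀/ℚ)`.  So:
**a real quadratic factor NEVER rescues a BAD field** (`K = K₀(√d)`, `d > 0`, `√d ∉ K₀`).  With `CorCM/GaloisDegenerateExtension`
(`[K:K₀] ≥ 3`, anything): the only monotonicity question left is the quadratic extension NOT split through complex conjugation
(`Gal(K/K₀) ≤ Φ(Gal(K/ℚ))`-type, or split only through complements avoiding `c`).

## References

* [Kubota1965] T. Kubota, *On the field extension by complex multiplication*, Trans. AMS 118 (1965), §2, §4 Lemma 2.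
* [Shimura1998] G. Shimura, *Abelian Varieties with Complex Multiplication and Modular Functions*, §6.2 Thm. 3, §8.2 Prop. 26.
* [Gordon1999HodgeAVSurvey] B. B. Gordon, *A survey of the Hodge conjecture for abelian varieties*, Thm. 6.4, §9.3, §9.4.3.
-/

noncomputable section

open CategoryTheory CategoryTheory.Limits NumberField
open scoped BigOperators

namespace Summit.HodgeConjecture.CorCM.GaloisModels

open Literature.NumberTheory.ComplexMultiplication
open Literature.AlgebraicGeometry.Motives (AbelianVariety CMType)
open Literature.AlgebraicGeometry.HodgeTheory
open Literature.AlgebraicGeometry.ComplexMultiplication (IsCMTypeRealisation)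
open Literature.AlgebraicGeometry.Pohlmann1968
open Literature.Barriers.HodgeConjecture (divisorClassesSpan)
open Summit.HodgeConjecture.CorCM.GaloisRank
open Summit.HodgeConjecture.CorCM.AbelianTwoPowerClassification

section Field

variable {K : Type} [Field K] [NumberField K] [IsCMField K] [IsGalois ℚ K]
variable (K₀ : Type) [Field K₀] [NumberField K₀] [IsCMField K₀] [IsGalois ℚ K₀] [Algebra K₀ K] [IsScalarTower ℚ K₀ K]

omit [IsCMField K] [IsCMField K₀] in
/-- **`[K:K₀] = 2` with a complement and `Gal(K₀/ℚ)` of exponent `2` ⟹ `Gal(K/ℚ)` of exponent `2`**: `g = γ m` with `γ ∈ Γ`,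
`m` in the (central, order-`2`) kernel, so `g² = γ²`, which restricts trivially and lies in `Γ`. [folklore] -/
theorem sq_eq_one_of_complement_two (Γ : Subgroup (K ≃ₐ[ℚ] K))
    (hdisj : ∀ g ∈ Γ, AlgEquiv.restrictNormalHom K₀ g = 1 → g = 1) (hcard : Nat.card Γ = Module.finrank ℚ K₀)
    (hdeg : Module.finrank K₀ K = 2) (hsq₀ : ∀ q : K₀ ≃ₐ[ℚ] K₀, q * q = 1) (g : K ≃ₐ[ℚ] K) : g * g = 1 := by
  -- restriction is a bijection `Γ → Gal(K₀/ℚ)`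
  set ρ : Γ →* (K₀ ≃ₐ[ℚ] K₀) := (AlgEquiv.restrictNormalHom K₀).restrict Γ with hρ_def
  have hρinj : Function.Injective ρ := by
    intro x y h
    apply Subtype.ext
    have h' : AlgEquiv.restrictNormalHom K₀ ((x : K ≃ₐ[ℚ] K) * (y : K ≃ₐ[ℚ] K)⁻¹) = 1 := by
      rw [map_mul, map_inv, mul_inv_eq_one]
      exact h
    exact mul_inv_eq_one.1 (hdisj _ (Γ.mul_mem x.2 (Γ.inv_mem y.2)) h')
  have hρbij : Function.Bijective ρ := hρinj.bijective_of_nat_card_le (by rw [IsGalois.card_aut_eq_finrank, hcard])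
  obtain ⟨γ, hγ⟩ := hρbij.2 (AlgEquiv.restrictNormalHom K₀ g)
  have hγ' : AlgEquiv.restrictNormalHom K₀ (γ : K ≃ₐ[ℚ] K) = AlgEquiv.restrictNormalHom K₀ g := hγ
  -- the kernel `{1, n₁}` is central of order `2`
  obtain ⟨τ, hτ, hker⟩ := eq_one_or_eq_of_restrictNormalHom_eq_one K₀ hdeg
  have hone : ((1 : K ≃ₐ[K₀] K).restrictScalars ℚ : K ≃ₐ[ℚ] K) = 1 := AlgEquiv.ext fun x => rfl
  have h₁ : (τ.restrictScalars ℚ : K ≃ₐ[ℚ] K) ≠ 1 := fun h =>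
    hτ (AlgEquiv.restrictScalars_injective ℚ (h.trans hone.symm))
  have hn₁ := restrictNormalHom_restrictScalars_eq_one K₀ τ
  have hcen := SplitExtension.kerTwo_comm hn₁ h₁ hker
  have hinv := SplitExtension.kerTwo_mul_self hn₁ h₁ hker
  -- `m = γ⁻¹ g` lies in the kernel
  have hm : AlgEquiv.restrictNormalHom K₀ ((γ : K ≃ₐ[ℚ] K)⁻¹ * g) = 1 := by rw [map_mul, map_inv, hγ', inv_mul_cancel]
  -- `γ² = 1`
  have hγ2 : (γ : K ≃ₐ[ℚ] K) * γ = 1 :=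
    hdisj _ (Γ.mul_mem γ.2 γ.2) (by rw [map_mul, hsq₀])
  rcases hker _ hm with h | h
  · have hg : g = γ := (inv_mul_eq_one.1 h).symm
    rw [hg, hγ2]
  · have hg : g = (γ : K ≃ₐ[ℚ] K) * τ.restrictScalars ℚ := by rw [← h, mul_inv_cancel_left]
    rw [hg, mul_assoc, ← mul_assoc (τ.restrictScalars ℚ : K ≃ₐ[ℚ] K), ← hcen (γ : K ≃ₐ[ℚ] K), mul_assoc, hinv, mul_one,
      hγ2]

/-- **A QUADRATIC EXTENSION SPLIT THROUGH COMPLEX CONJUGATION NEVER RESCUES A BAD FIELD — unconditionally.**  `K ⊇ K₀ ⊇ ℚ`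
Galois CM with `[K : K₀] = 2`; `Γ ≤ Gal(K/ℚ)` containing complex conjugation, meeting `Gal(K/K₀)` trivially, `|Γ| = [K₀:ℚ]`;
`K₀` has a PRIMITIVE DEGENERATE CM type ⟹ `K` carries a SIMPLE DEGENERATE abelian variety of dimension `[K:ℚ]/2` with CM by
`K` (a rational `(p,p)` class outside the divisor ring on some power).  (`Gal(K₀/ℚ)` not of exponent `2`:
`CorCM/GaloisDegenerateRealQuadraticFactor`; of exponent `2`: the abelian classification.) [cite: Kubota1965, §2 and §4 Lemma 2]
[cite: Shimura1998, §6.2 Thm. 3 and §8.2 Prop. 26] [cite: Gordon1999HodgeAVSurvey, Thm. 6.4, §9.3 and §9.4.3] -/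
theorem exists_simple_degenerate_of_subfield_complement_two_all (Γ : Subgroup (K ≃ₐ[ℚ] K))
    (hcΓ : (IsCMField.complexConj K).restrictScalars ℚ ∈ Γ)
    (hdisj : ∀ g ∈ Γ, AlgEquiv.restrictNormalHom K₀ g = 1 → g = 1) (hcard : Nat.card Γ = Module.finrank ℚ K₀)
    (hdeg : Module.finrank K₀ K = 2) (Φ₀ : CMType K₀) (φ₀ : K₀ →+* ℂ) (hprim : IsPrimitive (ℂ ≃+* ℂ) Φ₀.1 φ₀)
    (hndg : ¬ IsNondegenerate Φ₀) :
    ∃ (Φ : CMType K) (φ : K →+* ℂ) (X : AbelianVariety ℂ) (ι : 𝓞 K →+* End X)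
      (ϑ : K →+* Module.End ℂ (complexBetti X.X 1)),
      IsPrimitive (ℂ ≃+* ℂ) Φ.1 φ ∧ ¬ IsNondegenerate Φ ∧ IsCMTypeRealisation Φ X ι ϑ ∧ X.IsSimple ∧
      X.dim = Module.finrank ℚ K / 2 ∧
      ∃ m p : ℕ, ∃ y : complexBetti (⨁ fun _ : Fin m => X).X (2 * p), IsRationalClass y ∧
        IsOfHodgeType (⨁ fun _ : Fin m => X).dim (⨁ fun _ : Fin m => X).X (2 * p) p p y ∧
        y ∉ divisorClassesSpan (⨁ fun _ : Fin m => X).X (⨁ fun _ : Fin m => X).dim p := by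
  by_cases hexp : ∃ q : K₀ ≃ₐ[ℚ] K₀, q * q ≠ 1
  · exact exists_simple_degenerate_of_subfield_complement_two K₀ Γ hcΓ hdisj hcard hdeg hexp Φ₀ φ₀ hprim hndg
  -- `Gal(K₀/ℚ)` and hence `Gal(K/ℚ)` have exponent `2`
  have hsq₀ : ∀ q : K₀ ≃ₐ[ℚ] K₀, q * q = 1 := fun q => not_not.1 fun h => hexp ⟨q, h⟩
  have hsq : ∀ g : K ≃ₐ[ℚ] K, g * g = 1 := sq_eq_one_of_complement_two K₀ Γ hdisj hcard hdeg hsq₀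
  have hinv₀ : ∀ q : K₀ ≃ₐ[ℚ] K₀, q⁻¹ = q := fun q => inv_eq_of_mul_eq_one_right (hsq₀ q)
  have hcomm₀ : ∀ g h : K₀ ≃ₐ[ℚ] K₀, g * h = h * g := fun g h =>
    calc g * h = (g * h)⁻¹ := (hinv₀ _).symm
      _ = h⁻¹ * g⁻¹ := mul_inv_rev g h
      _ = h * g := by rw [hinv₀, hinv₀]
  have hinvK : ∀ g : K ≃ₐ[ℚ] K, g⁻¹ = g := fun g => inv_eq_of_mul_eq_one_right (hsq g)
  have hcommK : ∀ g h : K ≃ₐ[ℚ] K, g * h = h * g := fun g h =>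
    calc g * h = (g * h)⁻¹ := (hinvK _).symm
      _ = h⁻¹ * g⁻¹ := mul_inv_rev g h
      _ = h * g := by rw [hinvK, hinvK]
  -- `[K₀:ℚ] = 2^k`, `k ≥ 1`
  have hP : IsPGroup 2 (K₀ ≃ₐ[ℚ] K₀) := fun q => ⟨1, by rw [pow_one, pow_two]; exact hsq₀ q⟩
  obtain ⟨k, hk⟩ := IsPGroup.iff_card.1 hP
  have hK₀ : Module.finrank ℚ K₀ = 2 ^ k := by rw [← IsGalois.card_aut_eq_finrank, hk]
  have hk1 : 1 ≤ k := by
    by_contra h0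
    have hk0 : k = 0 := by omega
    rw [hk0, pow_zero] at hk
    have hsub : Subsingleton (K₀ ≃ₐ[ℚ] K₀) := (Nat.card_eq_one_iff_unique.1 hk).1
    exact model_complexConj_ne_one (K := K₀) (MulEquiv.refl _) rfl (Subsingleton.elim _ _)
  have hK₀' : Module.finrank ℚ K₀ = 2 ^ (k - 1 + 1) := by rw [Nat.sub_add_cancel hk1]; exact hK₀
  by_cases h16 : Module.finrank ℚ K₀ ≤ 16
  · -- (β) or (γ): `K₀` cannot be BAD
    exfalso
    refine hndg (isNondegenerate_of_isPrimitive_of_good hcomm₀ hK₀' (Or.inr ?_) φ₀ hprim)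
    rcases Nat.lt_or_ge k 4 with hk4 | hk4
    · left
      rw [hK₀]
      calc 2 ^ k ≤ 2 ^ 3 := Nat.pow_le_pow_right (by norm_num) (by omega)
        _ = 8 := by norm_num
    · right
      refine ⟨?_, fun q => Or.inl (hsq₀ q)⟩
      have h16' : 16 ≤ Module.finrank ℚ K₀ := by
        rw [hK₀]
        calc (16 : ℕ) = 2 ^ 4 := by norm_num
          _ ≤ 2 ^ k := Nat.pow_le_pow_right (by norm_num) hk4
      omega
  · -- `[K:ℚ] = 2^(k+1) ≥ 32` and ¬(α) for the exponent-two group `Gal(K/ℚ)`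
    have hKK : Module.finrank ℚ K = 2 ^ (k + 1) := by
      rw [← Module.finrank_mul_finrank ℚ K₀ K, hK₀, hdeg, pow_succ]
    have h32 : 32 ≤ Module.finrank ℚ K := by
      rw [← Module.finrank_mul_finrank ℚ K₀ K, hdeg]; omega
    have hα : ¬ ∃ z : K ≃ₐ[ℚ] K, (IsCMField.complexConj K).restrictScalars ℚ ∈ Subgroup.zpowers z ∧
        (Subgroup.zpowers z).index ≤ 2 := by
      rintro ⟨z, -, hidx⟩
      have hord : orderOf z ≤ 2 := by
        have h : orderOf z ∣ 2 := orderOf_dvd_of_pow_eq_one (by rw [pow_two]; exact hsq z)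
        exact Nat.le_of_dvd two_pos h
      have hprod := Subgroup.index_mul_card (Subgroup.zpowers z)
      rw [Nat.card_zpowers, IsGalois.card_aut_eq_finrank] at hprod
      have : (Subgroup.zpowers z).index * orderOf z ≤ 2 * 2 := Nat.mul_le_mul hidx hord
      omega
    obtain ⟨Φ, φ, X, ι, ϑ, H1, H2, H3, H4, H5, H6⟩ := exists_simple_degenerate_of_not_thin_of_le_finrank hcommK hKK h32 hα
    refine ⟨Φ, φ, X, ι, ϑ, H1, H2, H3, H4, ?_, H6⟩
    rw [H5, hKK, pow_succ, Nat.mul_div_cancel _ two_pos]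

end Field

end Summit.HodgeConjecture.CorCM.GaloisModels

end
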